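import Mathlib
import HarnessLib
import Summits.HubbardSuperconductivity.HubbardSuperconductivity.Theorems.KLProgrammeKLRegimeCountertermJacksonRemainderCertDefs
import Summits.HubbardSuperconductivity.HubbardSuperconductivity.Theorems.KLProgrammeKLRegimeSplitTwoLegF

/-!
# (C1) CUTOFF-DEFECT CERTIFICATE — the FRAME-QUANTIFIED named hypothesis `CutoffDefectCertFrame d A T`

Seat hubbard-kl-k3c3-p1 (g7), stmt-HubbardSuperconductivity-20437 stub (C).  Companion of `CutoffDefectCert` (`…CertDefs`): the same 27 kernel
moments, but the certificate quantifies DIRECTLY over the new frame `K′` through sup-norm bounds `‖Dʲ(evalM K′)‖ ≤ A j` (`j ≤ 4`), the regularity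
of its polar Fermi radius and the on-curve identity; the polar-jet box around the free radius at the curve's own level is then DERIVED inside the
certified computation (interval implicit jet recursion, evidence `C1-CERT.md` §2(f)), so the consumer needs no polar-jet perturbation lemma —
only frame sizes (`FrameOK`-type data).  Definition only; nothing here asserts superconductivity.
-/

noncomputable section

namespace Summit.HubbardSuperconductivity.HubbardSuperconductivity.Theorems.KLRegimeSplit

set_option linter.dupNamespace false -- summit = problem name (single-conjunct summit), D-0017

open Real MeasureTheory
open Literature.MathematicalPhysics.QuantumLattice
open Summit.HubbardSuperconductivity.HubbardSuperconductivity.Theorems.PerturbedFermiCurve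

/-- **`CutoffDefectCertFrame d A T` — THE FRAME-QUANTIFIED (C1) CERTIFICATE HYPOTHESIS for Jackson degree `d`.**  For every level `μ ∈ klWindowC`
and every frame `K′` with `‖Dʲ(evalM K′)(p)‖ ≤ A j` (`j ≤ 4`, all `p`), whose polar Fermi radius `r = perturbedFermiRadius (−K′.eval) μ` is `C⁴`
and whose Fermi points lie on the frame curve (`ε(k_F^{K′}ϑ) − μ = K′(k_F^{K′}ϑ)`), and every base angle `θ ∈ [−π, π]`: there are majorants
`nq i, mq k i l, tq k l, uq k, dq` on the smoothing square, integrable against `J̃_dJ̃_d`, dominating for a.e. displacement `w` the cutoff-defect /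
mixed / transport products of `CutoffDefectCert` built from `certCutoff μ r w` and `certAngle r w`, with kernel moments below the table `T`.
Certified by interval arithmetic on kit (evidence on stmt-…-20437); consumed by `…CountertermJacksonRemainderCertFrame`. -/
def CutoffDefectCertFrame (d : ℕ) (A : ℕ → ℝ) (T : CutoffDefectTable) : Prop :=
  ∀ μ ∈ klWindowC, ∀ K' : TrigPolyC4v,
    (∀ j ≤ 4, ∀ p : EuclideanSpace ℝ (Fin 2), ‖iteratedFDeriv ℝ j (fun q : EuclideanSpace ℝ (Fin 2) => K'.eval (WithLp.ofLp q)) p‖ ≤ A j) →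
    ContDiff ℝ 4 (perturbedFermiRadius (fun p => -K'.eval p) μ) →
    (∀ ϑ : ℝ, freeBandFn (klFermiPoint μ K' ϑ) - μ = K'.eval (klFermiPoint μ K' ϑ)) →
    ∀ θ ∈ Set.Icc (-π) π,
    ∃ (nq : ℕ → ℝ × ℝ → ℝ) (mq : ℕ → ℕ → ℕ → ℝ × ℝ → ℝ) (tq : ℕ → ℕ → ℝ × ℝ → ℝ) (uq : ℕ → ℝ × ℝ → ℝ) (dq : ℝ × ℝ → ℝ),
      (∀ i, Integrable (fun w => jweight d w * nq i w) jmeas) ∧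
      (∀ k i l, Integrable (fun w => jweight d w * mq k i l w) jmeas) ∧
      (∀ k l, Integrable (fun w => jweight d w * tq k l w) jmeas) ∧
      (∀ k, Integrable (fun w => jweight d w * uq k w) jmeas) ∧
      Integrable (fun w => jweight d w * dq w) jmeas ∧
      (∀ᵐ w ∂jmeas,
        |certCutoff μ (perturbedFermiRadius (fun p => -K'.eval p) μ) w θ - 1| ≤ nq 0 w ∧
        (∀ i, 1 ≤ i → i ≤ 4 → |iteratedDeriv i (certCutoff μ (perturbedFermiRadius (fun p => -K'.eval p) μ) w) θ| ≤ nq i w) ∧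
        (∀ k i l, 1 ≤ i → i < k → k ≤ 4 → 1 ≤ l → l ≤ k - i →
          |iteratedDeriv i (certCutoff μ (perturbedFermiRadius (fun p => -K'.eval p) μ) w) θ| *
            bellP (k - i) l (certAngleJets (perturbedFermiRadius (fun p => -K'.eval p) μ) w θ) ≤ mq k i l w) ∧
        (∀ k l, 1 ≤ l → l < k → k ≤ 4 →
          |certCutoff μ (perturbedFermiRadius (fun p => -K'.eval p) μ) w θ| *
            bellP k l (certAngleJets (perturbedFermiRadius (fun p => -K'.eval p) μ) w θ) ≤ tq k l w) ∧
        (∀ k, 1 ≤ k → k ≤ 4 →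
          |certCutoff μ (perturbedFermiRadius (fun p => -K'.eval p) μ) w θ| *
            |iteratedDeriv 1 (certAngle (perturbedFermiRadius (fun p => -K'.eval p) μ) w) θ ^ k - 1| ≤ uq k w) ∧
        |certCutoff μ (perturbedFermiRadius (fun p => -K'.eval p) μ) w θ| *
          |toIocMod Real.two_pi_pos (-π) (certAngle (perturbedFermiRadius (fun p => -K'.eval p) μ) w θ - θ)| ≤ dq w) ∧
      (∫ w, jweight d w * nq 0 w ∂jmeas ≤ T.N0) ∧
      (∀ i, 1 ≤ i → i ≤ 4 → ∫ w, jweight d w * nq i w ∂jmeas ≤ T.N i) ∧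
      (∀ k i l, 1 ≤ i → i < k → k ≤ 4 → 1 ≤ l → l ≤ k - i → ∫ w, jweight d w * mq k i l w ∂jmeas ≤ T.Mc k i l) ∧
      (∀ k l, 1 ≤ l → l < k → k ≤ 4 → ∫ w, jweight d w * tq k l w ∂jmeas ≤ T.Tt k l) ∧
      (∀ k, 1 ≤ k → k ≤ 4 → ∫ w, jweight d w * uq k w ∂jmeas ≤ T.Tu k) ∧
      (∫ w, jweight d w * dq w ∂jmeas ≤ T.Td)

end Summit.HubbardSuperconductivity.HubbardSuperconductivity.Theorems.KLRegimeSplit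

end
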